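import Literature.AlgebraicTopology.Homotopy.WangPowerFormula
import Literature.AlgebraicTopology.Homotopy.SphereThreeCoverFibre
import Literature.AlgebraicTopology.Homotopy.SphereConnectedCoverConnectivity
import Literature.AlgebraicTopology.SingularHomology.CohomologyOfPoint
import HarnessLib

/-!
# The integral cohomology of `S³⟨3⟩`: `H²ʲ⁺² = 0`, `H²ʲ⁺³ ≅ ℤ/(j+1)`

J.-P. Serre, *Homologie singulière des espaces fibrés*, Ann. of Math. 54 (1951), Ch. III §7 /
Ch. IV (the `3`-connected cover of `S³`), as presented in A. Hatcher, *Spectral Sequences in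
Algebraic Topology* (2004), §1.1, Example 1.17 (p. 25): for the fibration `K(ℤ, 2) → X → S³`
killing `π₃`, "`d(xⁿ) = n xⁿ⁻¹ dx`, `dx` a generator … hence `H^{2k+1}(X; ℤ) ≈ ℤ_k` and
`H^{2k}(X; ℤ) = 0` for `k > 0`" (equivalently `H_{2k}(X) ≈ ℤ_k`: the first `p`-torsion of
`π_*(S³)` is in degree `2p`). Here with the WANG SEQUENCE of the tree (`WangSequence.lean`,
Whitehead VII.7.14) in place of the Serre spectral sequence, for the cover
`E = SphereCover.E 3 v → 𝕊³` (`SphereConnectedCover.lean`) with fibre `F = K(ℤ, 2)`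
(`H*(F; ℤ) = ℤ[x]`, `SphereThreeCoverFibre.lean`), `H²(E) = H³(E) = 0`
(`SphereConnectedCoverConnectivity.lean`) and `D(xʲ⁺¹) = (j+1) xʲ ⌣ Dx` (`WangPowerFormula.lean`).
PROVED (no definitions, no named facts), for every choice of poles `P₀ : Wang.Poles 1`
(`v = P₀.v`):

* `SphereCover.exists_generator_D` — a generator `x ∈ H²(F; ℤ)` of the polynomial ring with
  `D x = ±1` (`D : H²(F) → H⁰(F)` is onto because `H³(E) = 0`);
* **`SphereCover.isZero_singularCohomology_three_cover_even`** — `H²ʲ⁺²(S³⟨3⟩; ℤ) = 0`;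
* **`SphereCover.nonempty_singularCohomology_three_cover_odd`** —
  `H²ʲ⁺³(S³⟨3⟩; ℤ) ≅ ℤ ⧸ (j + 1)`;
* `SphereCover.isZero_singularCohomology_three_cover_one` — `H¹(S³⟨3⟩; ℤ) = 0`.

Scalar discipline: all `ℤ`-multiples below are produced by Mathlib lemmas (`Submodule.mem_span_singleton`,
`LinearMap.map_smul`), never written by hand, so that only the module scalar action of the
cohomology groups occurs (the group `zsmul` is a different instance on `ModuleCat ℤ` objects).

## References

* J.-P. Serre, Ann. of Math. 54 (1951), Ch. III §7, Ch. IV. [Serre1951]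
* A. Hatcher, *Algebraic Topology* (2002), §4.3 Example 4.72; *Spectral Sequences* Example 1.17.
  [HatcherAT2002]
* G. W. Whitehead, *Elements of Homotopy Theory* (1978), Ch. VII §7 Thm. 7.14. [Whitehead1978]
-/

noncomputable section

open Set Function Metric Topology CategoryTheory CategoryTheory.Limits
open scoped unitInterval Topology
open Literature.AlgebraicTopology.SingularHomology Literature.Topology.FourManifolds

namespace Literature.AlgebraicTopology.Homotopy

namespace SphereCover

variable (P₀ : Wang.Poles 1)

/-- The Hurewicz-fibration hypothesis of the Wang sequence for the cover. [folklore] -/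
theorem hp3 : IsHurewiczFibration.{0, 0, 0} (proj 3 P₀.v) := isHurewiczFibration_proj 3 P₀.v

/-- The Serre-fibration hypothesis of the Wang sequence for the cover. [folklore] -/
theorem hpS3 : IsSerreFibration (proj 3 P₀.v) := isSerreFibration_proj 3 P₀.v

/-! ### Two generalities -/

/-- Elements of a zero module vanish. [folklore] -/
theorem eq_zero_of_isZero {M : ModuleCat ℤ} (h : IsZero M) (b : M) : b = 0 := by
  haveI := ModuleCat.subsingleton_of_isZero h
  exact Subsingleton.elim _ _

/-- A vanishing module is a zero object. [folklore] -/
theorem isZero_of_forall_eq_zero {M : ModuleCat ℤ} (h : ∀ b : M, b = 0) : IsZero M := by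
  haveI : Subsingleton M := ⟨fun a b => by rw [h a, h b]⟩
  exact ModuleCat.isZero_of_subsingleton _

/-! ### The generator and `D x = ±1` -/

set_option maxHeartbeats 400000 in
/-- **A generator `x` of `H*(F; ℤ) = ℤ[x]` with `D x = ±1`**: `D : H²(F) → H⁰(F)` is onto (its
cokernel embeds in `H³(E) = 0` by the Wang sequence), and `1` generates `H⁰(F)`.
[cite: Serre1951, Ch. III §7] [cite: Whitehead1978, Ch. VII §7, Thm. 7.14] -/
theorem exists_generator_D :
    ∃ x : singularCohomology ℤ ℤ (Fib 3 P₀.v) 2,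
      (∀ j : ℕ, Submodule.span ℤ {cupPowL x j} = ⊤) ∧
      (Wang.D ℤ P₀ (hp3 P₀) (hpS3 P₀) 0 x = singularCohomology.one ℤ (Fib 3 P₀.v) ∨
        Wang.D ℤ P₀ (hp3 P₀) (hpS3 P₀) 0 x = -singularCohomology.one ℤ (Fib 3 P₀.v)) := by
  obtain ⟨x, hx, hpow⟩ := exists_generator_fib_three P₀.v
  -- `D` is onto `H⁰(F)`: `λ b ∈ H³(E) = 0`
  have hD : ∀ b : singularCohomology ℤ ℤ (Fib 3 P₀.v) 0, ∃ y, Wang.D ℤ P₀ (hp3 P₀) (hpS3 P₀) 0 y = b := fun b => by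
    rw [← Wang.lam_eq_zero_iff ℤ P₀ (hp3 P₀) (hpS3 P₀) 0 b]
    exact eq_zero_of_isZero (isZero_singularCohomology_E 1 P₀.v (i := 3) (by omega) le_rfl) _
  -- `1 = D (a • x) = a • D x`
  obtain ⟨y, hy⟩ := hD (singularCohomology.one ℤ (Fib 3 P₀.v))
  have hyx : y ∈ Submodule.span ℤ {x} := by rw [hx]; exact Submodule.mem_top
  obtain ⟨a, rfl⟩ := Submodule.mem_span_singleton.1 hyx
  rw [LinearMap.map_smul] at hy
  -- `D x = b • 1`
  have hone : Submodule.span ℤ {singularCohomology.one ℤ (Fib 3 P₀.v)} = ⊤ := by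
    have := hpow 0
    rwa [cupPowL_zero] at this
  have hux : Wang.D ℤ P₀ (hp3 P₀) (hpS3 P₀) 0 x ∈ Submodule.span ℤ {singularCohomology.one ℤ (Fib 3 P₀.v)} := by
    rw [hone]; exact Submodule.mem_top
  obtain ⟨b, hb⟩ := Submodule.mem_span_singleton.1 hux
  -- read in `H⁰(F) ≅ ℤ`: `a * b = 1`
  let e₀ := singularCohomologyZeroEquiv ℤ ℤ (Fib 3 P₀.v)
  have he₀ : e₀ (singularCohomology.one ℤ (Fib 3 P₀.v)) = 1 ∨ e₀ (singularCohomology.one ℤ (Fib 3 P₀.v)) = -1 :=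
    (span_singleton_eq_top_iff_of_equiv e₀ _).1 hone
  have hab : a * b = 1 := by
    have h1 := congrArg e₀ hy
    rw [← hb, LinearEquiv.map_smul, LinearEquiv.map_smul, smul_eq_mul, smul_eq_mul] at h1
    -- `h1 : a * (b * e₀ 1) = e₀ 1`
    have hne : e₀ (singularCohomology.one ℤ (Fib 3 P₀.v)) ≠ 0 := by
      rcases he₀ with h | h <;> rw [h] <;> norm_num
    have h2 : (a * b - 1) * e₀ (singularCohomology.one ℤ (Fib 3 P₀.v)) = 0 := by
      rw [sub_mul, one_mul, mul_assoc, h1, sub_self]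
    exact sub_eq_zero.1 ((mul_eq_zero.1 h2).resolve_right hne)
  refine ⟨x, hpow, ?_⟩
  have hval : e₀ (Wang.D ℤ P₀ (hp3 P₀) (hpS3 P₀) 0 x) = b * e₀ (singularCohomology.one ℤ (Fib 3 P₀.v)) := by
    rw [← hb, LinearEquiv.map_smul, smul_eq_mul]
  rcases Int.eq_one_or_neg_one_of_mul_eq_one' hab with ⟨-, h⟩ | ⟨-, h⟩
  · left
    apply e₀.injective
    rw [hval, h, one_mul]
  · right
    apply e₀.injective
    rw [hval, h, map_neg, neg_one_mul]

/-- In a rank-one lattice with generator `g`, a class is determined by its `e`-coordinate, which is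
a multiple of `e g = ±1`; in particular `e w = 0` forces `w = 0` and `e g ≠ 0`. [folklore] -/
theorem apply_generator_ne_zero {M : Type*} [AddCommGroup M] [Module ℤ M] (e : M ≃ₗ[ℤ] ℤ) {g : M}
    (hg : Submodule.span ℤ {g} = ⊤) : e g ≠ 0 := by
  rcases (span_singleton_eq_top_iff_of_equiv e g).1 hg with h | h <;> rw [h] <;> norm_num

/-! ### Even degrees -/

set_option maxHeartbeats 400000 in
/-- **`H²ʲ⁺²(S³⟨3⟩; ℤ) = 0`** (Serre 1951; Hatcher SSAT Ex. 1.17: "`H^{2k}(X) = 0` for `k > 0`"): the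
restriction to the fibre is injective on `H²ʲ⁺²(E)` (its kernel is `λ(H²ʲ⁻¹(F)) = 0`) with image
`ker D`, and `D(a xʲ⁺¹) = ±a (j+1) xʲ` vanishes only for `a = 0`. [cite: Serre1951, Ch. III §7]
[cite: HatcherAT2002, §4.3 Example 4.72] -/
theorem isZero_singularCohomology_three_cover_even (j : ℕ) :
    IsZero (singularCohomology ℤ ℤ (E 3 P₀.v) (2 * j + 2)) := by
  rcases Nat.eq_zero_or_pos j with rfl | hj
  · exact isZero_singularCohomology_E 1 P₀.v (i := 2) (by omega) (by omega)
  obtain ⟨j, rfl⟩ : ∃ j', j = j' + 1 := ⟨j - 1, by omega⟩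
  obtain ⟨x, hpow, hDx⟩ := exists_generator_D P₀
  -- `H^{2j+2}(F) ≅ ℤ` with generator `xʲ⁺¹`
  obtain ⟨e2⟩ : Nonempty (singularCohomology ℤ ℤ (Fib 3 P₀.v) (2 * (j + 1)) ≃ₗ[ℤ] ℤ) :=
    nonempty_singularCohomology_fib_three_equiv_int P₀.v j
  have hgen : e2 (cupPowL x (j + 1)) ≠ 0 := apply_generator_ne_zero e2 (hpow (j + 1))
  refine isZero_of_forall_eq_zero fun z => ?_
  -- `ι^* z = a • x^{j+2}` with `D (ι^* z) = 0`
  have hDy : Wang.D ℤ P₀ (hp3 P₀) (hpS3 P₀) (2 * (j + 1))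
      (singularCohomology.map ℤ ℤ (Wang.fibIncl P₀ (proj 3 P₀.v)) (2 * (j + 1) + 2) z) = 0 :=
    (Wang.mem_range_iff_D_eq_zero ℤ P₀ (hp3 P₀) (hpS3 P₀) (2 * (j + 1)) _).1 ⟨z, rfl⟩
  have hyx : singularCohomology.map ℤ ℤ (Wang.fibIncl P₀ (proj 3 P₀.v)) (2 * (j + 1) + 2) z ∈
      Submodule.span ℤ {cupPowL x (j + 1 + 1)} := by rw [hpow]; exact Submodule.mem_top
  obtain ⟨a, ha⟩ := Submodule.mem_span_singleton.1 hyx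
  have hDpow := Wang.D_cupPowL ℤ P₀ (hp3 P₀) (hpS3 P₀) x (j + 1)
  -- `a = 0`
  have ha0 : a = 0 := by
    rw [← ha, LinearMap.map_smul, hDpow] at hDy
    -- `hDy : a • ((j+2) • (x^{j+1} ⌣ D x)) = 0`; read it in `ℤ` through `e2`
    have h1 := congrArg e2 hDy
    rw [LinearEquiv.map_smul, LinearEquiv.map_smul, map_zero, smul_eq_mul, smul_eq_mul] at h1
    have hw : e2 (cupProduct (rfl : 2 * (j + 1) + 0 = 2 * (j + 1)) (cupPowL x (j + 1))
        (Wang.D ℤ P₀ (hp3 P₀) (hpS3 P₀) 0 x)) ≠ 0 := by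
      rcases hDx with h | h
      · rw [h, cupProduct_one]; exact hgen
      · rw [h, map_neg, cupProduct_one, map_neg, neg_ne_zero]; exact hgen
    have hj1 : ((j + 1 + 1 : ℕ) : ℤ) ≠ 0 := by positivity
    exact (mul_eq_zero.1 h1).resolve_right (mul_ne_zero hj1 hw)
  have hy0 : singularCohomology.map ℤ ℤ (Wang.fibIncl P₀ (proj 3 P₀.v)) (2 * (j + 1) + 2) z = 0 := by
    obtain ⟨e3⟩ := nonempty_singularCohomology_fib_three_equiv_int P₀.v (j + 1)
    apply e3.injective
    rw [map_zero, ← ha, LinearEquiv.map_smul, smul_eq_mul, ha0, zero_mul]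
  -- `ι^*` is injective on `H^{2j+4}(E)`: its kernel is `λ(H^{2j+1}(F)) = 0`
  obtain ⟨b, hb⟩ := (Wang.mem_range_lam_iff ℤ P₀ (hp3 P₀) (hpS3 P₀) (2 * j + 1) z).2 hy0
  have hb0 : b = 0 :=
    eq_zero_of_isZero (isZero_singularCohomology_fib_three_of_odd P₀.v (i := 2 * j + 1)
      (Nat.not_even_iff_odd.2 ⟨j, rfl⟩)) _
  rw [← hb, hb0, map_zero]

/-- **`H¹(S³⟨3⟩; ℤ) = 0`.** [cite: HatcherAT2002, §4.3 Example 4.72] -/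
theorem isZero_singularCohomology_three_cover_one : IsZero (singularCohomology ℤ ℤ (E 3 P₀.v) 1) :=
  isZero_singularCohomology_E 1 P₀.v le_rfl (by omega)

/-! ### Odd degrees -/

set_option maxHeartbeats 400000 in
/-- **`H²ʲ⁺³(S³⟨3⟩; ℤ) ≅ ℤ ⧸ (j + 1)`** (Serre 1951; Hatcher SSAT Ex. 1.17: "`H^{2k+1}(X) ≈ ℤ_k`"):
`λ : H²ʲ(F) → H²ʲ⁺³(E)` is onto (the next term `H²ʲ⁺³(F)` vanishes) with kernel
`D(H²ʲ⁺²(F)) = (j+1) H²ʲ(F)`, and `H²ʲ(F) ≅ ℤ`. In particular the first `p`-torsion of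
`H*(S³⟨3⟩; ℤ)` sits in degree `2p + 1`. [cite: Serre1951, Ch. III §7] [cite: HatcherAT2002, §4.3 Example 4.72] -/
theorem nonempty_singularCohomology_three_cover_odd (j : ℕ) :
    Nonempty ((ℤ ⧸ Ideal.span {((j + 1 : ℕ) : ℤ)}) ≃ₗ[ℤ] singularCohomology ℤ ℤ (E 3 P₀.v) (2 * j + 3)) := by
  obtain ⟨x, hpow, hDx⟩ := exists_generator_D P₀
  -- `H^{2j}(F) ≅ ℤ` with `e (xʲ) = 1`
  have he : ∃ e : singularCohomology ℤ ℤ (Fib 3 P₀.v) (2 * j) ≃ₗ[ℤ] ℤ, e (cupPowL x j) = 1 := by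
    obtain ⟨e⟩ : Nonempty (singularCohomology ℤ ℤ (Fib 3 P₀.v) (2 * j) ≃ₗ[ℤ] ℤ) := by
      rcases Nat.eq_zero_or_pos j with rfl | hj
      · exact ⟨singularCohomologyZeroEquiv ℤ ℤ (Fib 3 P₀.v)⟩
      · obtain ⟨j, rfl⟩ : ∃ j', j = j' + 1 := ⟨j - 1, by omega⟩
        exact nonempty_singularCohomology_fib_three_equiv_int P₀.v j
    rcases (span_singleton_eq_top_iff_of_equiv e (cupPowL x j)).1 (hpow j) with h1 | h1
    · exact ⟨e, h1⟩
    · exact ⟨e.trans (LinearEquiv.neg ℤ), by rw [LinearEquiv.trans_apply, LinearEquiv.neg_apply, h1, neg_neg]⟩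
  obtain ⟨e, he1⟩ := he
  -- `w = xʲ ⌣ D x = ± xʲ`, so `e w = ± 1`
  have hw : e (cupProduct (rfl : 2 * j + 0 = 2 * j) (cupPowL x j) (Wang.D ℤ P₀ (hp3 P₀) (hpS3 P₀) 0 x)) = 1 ∨
      e (cupProduct (rfl : 2 * j + 0 = 2 * j) (cupPowL x j) (Wang.D ℤ P₀ (hp3 P₀) (hpS3 P₀) 0 x)) = -1 := by
    rcases hDx with h | h
    · left; rw [h, cupProduct_one, he1]
    · right; rw [h, map_neg, cupProduct_one, map_neg, he1]
  have hDpow := Wang.D_cupPowL ℤ P₀ (hp3 P₀) (hpS3 P₀) x j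
  -- the composite `g = λ ∘ e⁻¹ : ℤ → H^{2j+3}(E)`
  let g : ℤ →ₗ[ℤ] singularCohomology ℤ ℤ (E 3 P₀.v) (2 * j + 3) :=
    (Wang.lam ℤ P₀ (hp3 P₀) (2 * j)) ∘ₗ (e.symm : ℤ →ₗ[ℤ] singularCohomology ℤ ℤ (Fib 3 P₀.v) (2 * j))
  -- `g` is onto: `H^{2j+3}(F) = 0`
  have hg : Surjective g := fun z => by
    obtain ⟨b, hb⟩ := (Wang.mem_range_lam_iff ℤ P₀ (hp3 P₀) (hpS3 P₀) (2 * j) z).2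
      (eq_zero_of_isZero (isZero_singularCohomology_fib_three_of_odd P₀.v (i := 2 * j + 3)
        (Nat.not_even_iff_odd.2 ⟨j + 1, by ring⟩)) _)
    exact ⟨e b, by change Wang.lam ℤ P₀ (hp3 P₀) (2 * j) (e.symm (e b)) = z; rw [e.symm_apply_apply, hb]⟩
  -- `ker g = (j + 1) ℤ`
  have hker : LinearMap.ker g = Ideal.span {((j + 1 : ℕ) : ℤ)} := by
    apply le_antisymm
    · intro n hn
      rw [LinearMap.mem_ker] at hn
      change Wang.lam ℤ P₀ (hp3 P₀) (2 * j) (e.symm n) = 0 at hn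
      rw [Wang.lam_eq_zero_iff ℤ P₀ (hp3 P₀) (hpS3 P₀) (2 * j) (e.symm n)] at hn
      obtain ⟨y, hy⟩ := hn
      have hyx : y ∈ Submodule.span ℤ {cupPowL x (j + 1)} := by rw [hpow]; exact Submodule.mem_top
      obtain ⟨a, rfl⟩ := Submodule.mem_span_singleton.1 hyx
      rw [LinearMap.map_smul, hDpow] at hy
      have h1 := congrArg e hy
      rw [LinearEquiv.map_smul, LinearEquiv.map_smul, e.apply_symm_apply, smul_eq_mul, smul_eq_mul] at h1
      rw [Ideal.mem_span_singleton]
      rcases hw with h | h <;> rw [h] at h1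
      · exact ⟨a, by rw [← h1]; ring⟩
      · exact ⟨-a, by rw [← h1]; ring⟩
    · rw [Ideal.span_le, Set.singleton_subset_iff, SetLike.mem_coe, LinearMap.mem_ker]
      change Wang.lam ℤ P₀ (hp3 P₀) (2 * j) (e.symm ((j + 1 : ℕ) : ℤ)) = 0
      rw [Wang.lam_eq_zero_iff ℤ P₀ (hp3 P₀) (hpS3 P₀) (2 * j)]
      rcases hw with h | h
      · refine ⟨cupPowL x (j + 1), e.injective ?_⟩
        rw [hDpow, LinearEquiv.map_smul, h, e.apply_symm_apply, smul_eq_mul, mul_one]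
      · refine ⟨-cupPowL x (j + 1), e.injective ?_⟩
        rw [map_neg, hDpow, map_neg, LinearEquiv.map_smul, h, e.apply_symm_apply, smul_eq_mul, mul_neg_one,
          neg_neg]
  exact ⟨(Submodule.quotEquivOfEq _ _ hker).symm.trans (LinearMap.quotKerEquivOfSurjective g hg)⟩

end SphereCover

end Literature.AlgebraicTopology.Homotopy

end
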